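import Mathlib
import Summits.Ventures.PercRepro2.SeriesContractHMF
import Summits.Ventures.PercRepro2.ZeroEdges
import Summits.Ventures.PercRepro2.HMFLoop
import Summits.Ventures.PercRepro2.GcTransport

/-!
# THE SKELETON REDUCTION OF THE CRUX (blind cell PercRepro2, night-1 g15; NIGHT1-G15.md §5 — the
class form of S3-CLASSES.md (1))

Call an instance `(p, ends)` REDUCED (`Reduced`) if every unmarked vertex carries no loop of nonzero
weight and has nonzero-degree `0` or `≥ 3` (the number of edges at it with nonzero weight).
**`HCov_of_reduced` / `HMF_of_reduced`**: if (HCOV) (resp. (HMF)) holds on every reduced instance on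
the edge/vertex types `(E, V)`, it holds on every instance — every weight vector, every graph.  Proof
by strong induction on the number of nonzero-weight edges: a nonzero loop is zeroed
(`RECM.Gc_update_zero_eq_loop` / `HMFLoop.HMFc_update_zero_eq_loop`: a pinned-closed edge is a loop);
the zero-weight edges at a violating vertex are re-routed to loops at a mark (`Gc_congr_nz`, via
`ZeroEdges`: edge maps agreeing on the nonzero edges give the same functional), so that the vertex
is a structural leaf (nonzero-degree `1`: `Gc_update_leaf` / `HMFLeafInvisible.HMFc_update_leaf`)
or of structural degree two (nonzero-degree `2`: the series contraction
`SeriesCollapse.HCov_series_contract` / `HMF_series_contract`), each step removing one nonzero edge.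
So the crux (HCOV)/(HMF) on ALL graphs is equivalent to the crux on the graphs whose unmarked
vertices have degree `≥ 3` — the skeleton reduction of S3 (1) as a kernel theorem.
-/

open scoped Classical

namespace Summit.Ventures.PercRepro2

open UnionCluster CovForm PendantRoot

namespace Skeleton

section Defs

variable {V : Type*} {E : Type*} [Fintype E] {R : Type*} [Field R]

/-- The nonzero-weight edges. -/
noncomputable def nz (p : E → R) : Finset E := Finset.univ.filter (fun e => p e ≠ 0)

/-- The nonzero-degree of `v`: the number of edges at `v` with nonzero weight. -/
noncomputable def nzDeg (p : E → R) (ends : E → Sym2 V) (v : V) : ℕ :=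
  (Finset.univ.filter (fun e => v ∈ ends e ∧ p e ≠ 0)).card

/-- **Reduced instance**: every unmarked vertex carries no nonzero loop and has nonzero-degree `0`
or `≥ 3`. -/
def Reduced (p : E → R) (ends : E → Sym2 V) (o a₁ a₂ a₃ b : V) : Prop :=
  ∀ v, v ≠ o → v ≠ a₁ → v ≠ a₂ → v ≠ a₃ → v ≠ b →
    (∀ e, p e ≠ 0 → ends e ≠ s(v, v)) ∧ (nzDeg p ends v = 0 ∨ 3 ≤ nzDeg p ends v)

omit [Fintype E] in
/-- Membership in `nz`. -/
lemma mem_nz [Fintype E] {p : E → R} {e : E} : e ∈ nz p ↔ p e ≠ 0 := by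
  simp [nz]

/-- Zeroing a nonzero edge removes it from `nz`. -/
lemma nz_update_zero [DecidableEq E] (p : E → R) (f : E) :
    nz (Function.update p f 0) = (nz p).erase f := by
  ext e
  simp only [mem_nz, Finset.mem_erase]
  by_cases hef : e = f
  · subst hef; simp
  · simp [hef]

/-- The series contraction removes exactly the deleted edge from `nz`. -/
lemma nz_contract [DecidableEq E] (p : E → R) {f f' : E} (hff : f ≠ f') (hf' : p f' ≠ 0) :
    nz (Function.update (Function.update p f (p f * p f')) f' 0) = (nz p).erase f' := by
  ext e
  simp only [mem_nz, Finset.mem_erase]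
  by_cases he' : e = f'
  · subst he'; simp
  · rw [Function.update_of_ne he']
    by_cases hef : e = f
    · subst hef
      simp [he', hf']
    · simp [Function.update_of_ne hef, he']

end Defs

section Tools

variable {V : Type*} {E : Type*} [Fintype E] [DecidableEq E] [Fintype V] [DecidableEq V]
  {R : Type*} [Field R] [LinearOrder R] [IsStrictOrderedRing R]

omit [Fintype V] [DecidableEq V] [LinearOrder R] [IsStrictOrderedRing R] in
/-- `Gc` does not see the edges of weight `0` (the `Gc` companion of `ZeroEdges.HMFc_ext`). -/
theorem Gc_ext {keep : E → Prop} [DecidablePred keep] (p : E → R) (ends : E → Sym2 V)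
    (h0 : ∀ e, ¬ keep e → p e = 0) (o a₁ a₂ a₃ b : V) :
    Gc p ends o a₁ a₂ a₃ b = Gc (ZeroEdges.pR keep p) (ZeroEdges.endsR keep ends) o a₁ a₂ a₃ b := by
  simp only [Gc, EQbo, EQb3, EQb3o, Do, gap, DEF, EQo, EQ3, EQ3o, PDb, PDbo]
  simp only [ZeroEdges.prob_ext p h0, Set.preimage_inter, ZeroEdges.preimage_avoidAll,
    ZeroEdges.preimage_connEvent, ZeroEdges.preimage_PDEvent, ZeroEdges.preimage_TEvent]

omit [Fintype V] [DecidableEq V] [LinearOrder R] [IsStrictOrderedRing R] in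
/-- **Edge maps agreeing on the nonzero edges give the same `Gc`**: the zero-weight edges may be
re-routed anywhere. -/
theorem Gc_congr_nz (p : E → R) {ends ends' : E → Sym2 V} (h : ∀ e, p e ≠ 0 → ends e = ends' e)
    (o a₁ a₂ a₃ b : V) : Gc p ends o a₁ a₂ a₃ b = Gc p ends' o a₁ a₂ a₃ b := by
  have h0 : ∀ e, ¬ (p e ≠ 0) → p e = 0 := fun e he => not_not.1 he
  rw [Gc_ext (keep := fun e => p e ≠ 0) p ends h0, Gc_ext (keep := fun e => p e ≠ 0) p ends' h0]
  have : ZeroEdges.endsR (fun e => p e ≠ 0) ends = ZeroEdges.endsR (fun e => p e ≠ 0) ends' := by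
    funext e
    exact h e.1 e.2
  rw [this]

omit [LinearOrder R] [IsStrictOrderedRing R] in
/-- The same for the mean-field functional. -/
theorem HMFc_congr_nz (p : E → R) {ends ends' : E → Sym2 V} (h : ∀ e, p e ≠ 0 → ends e = ends' e)
    (o a₁ a₂ a₃ b : V) : HMFc p ends o a₁ a₂ a₃ b = HMFc p ends' o a₁ a₂ a₃ b := by
  have h0 : ∀ e, ¬ (p e ≠ 0) → p e = 0 := fun e he => not_not.1 he
  rw [ZeroEdges.HMFc_ext (keep := fun e => p e ≠ 0) p ends h0,
    ZeroEdges.HMFc_ext (keep := fun e => p e ≠ 0) p ends' h0]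
  have : ZeroEdges.endsR (fun e => p e ≠ 0) ends = ZeroEdges.endsR (fun e => p e ≠ 0) ends' := by
    funext e
    exact h e.1 e.2
  rw [this]

omit [Fintype V] [DecidableEq V] [LinearOrder R] [IsStrictOrderedRing R] in
/-- A loop can be zeroed without changing `Gc`. -/
theorem Gc_update_zero_of_loop (p : E → R) (ends : E → Sym2 V) {e : E} {x : V}
    (he : ends e = s(x, x)) (o a₁ a₂ a₃ b : V) :
    Gc (Function.update p e 0) ends o a₁ a₂ a₃ b = Gc p ends o a₁ a₂ a₃ b := by
  rw [RECM.Gc_update_zero_eq_loop p ends e x, Function.update_eq_self_iff.2 he.symm]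

omit [LinearOrder R] [IsStrictOrderedRing R] in
/-- A loop can be zeroed without changing `HMFc`. -/
theorem HMFc_update_zero_of_loop (p : E → R) (ends : E → Sym2 V) {e : E} {x : V}
    (he : ends e = s(x, x)) (o a₁ a₂ a₃ b : V) :
    HMFc (Function.update p e 0) ends o a₁ a₂ a₃ b = HMFc p ends o a₁ a₂ a₃ b := by
  rw [HMFLoop.HMFc_update_zero_eq_loop p ends e x, Function.update_eq_self_iff.2 he.symm]

/-- The re-routing of the zero-weight edges to loops at `a₁`. -/
noncomputable def reroute (p : E → R) (ends : E → Sym2 V) (a₁ : V) : E → Sym2 V :=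
  fun e => if p e = 0 then s(a₁, a₁) else ends e

omit [Fintype E] [DecidableEq E] [Fintype V] [DecidableEq V] [IsStrictOrderedRing R] in
/-- The re-routing agrees with `ends` on the nonzero edges. -/
lemma reroute_of_ne (p : E → R) (ends : E → Sym2 V) (a₁ : V) {e : E} (he : p e ≠ 0) :
    reroute p ends a₁ e = ends e := by
  simp [reroute, he]

omit [Fintype E] [DecidableEq E] [Fintype V] [DecidableEq V] [IsStrictOrderedRing R] in
/-- After the re-routing, every edge at a vertex `v ≠ a₁` has nonzero weight. -/
lemma ne_zero_of_mem_reroute (p : E → R) (ends : E → Sym2 V) {a₁ v : V} (hv : v ≠ a₁) {e : E}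
    (he : v ∈ reroute p ends a₁ e) : p e ≠ 0 := by
  intro h0
  simp only [reroute, h0, if_true, Sym2.mem_iff, or_self] at he
  exact hv he

omit [DecidableEq E] [Fintype V] [IsStrictOrderedRing R] in
/-- After the re-routing, the edges at `v ≠ a₁` are exactly the nonzero edges at `v` in `ends`:
their number is the nonzero-degree. -/
lemma card_filter_reroute (p : E → R) (ends : E → Sym2 V) {a₁ v : V} (hv : v ≠ a₁) :
    (Finset.univ.filter (fun e => v ∈ reroute p ends a₁ e)).card = nzDeg p ends v := by
  unfold nzDeg
  congr 1
  ext e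
  simp only [Finset.mem_filter, Finset.mem_univ, true_and]
  constructor
  · intro he
    have hne := ne_zero_of_mem_reroute p ends hv he
    rw [reroute_of_ne p ends a₁ hne] at he
    exact ⟨he, hne⟩
  · rintro ⟨he, hne⟩
    rw [reroute_of_ne p ends a₁ hne]
    exact he

end Tools

section Main

variable {V : Type*} {E : Type*} [Fintype E] [DecidableEq E] [Fintype V] [DecidableEq V]
  {R : Type*} [Field R] [LinearOrder R] [IsStrictOrderedRing R]

/-- **THE SKELETON REDUCTION OF (HCOV)**: if (HCOV) holds on every reduced instance on `(E, V)`, it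
holds on every instance. -/
theorem HCov_of_reduced (o a₁ a₂ a₃ b : V)
    (H : ∀ (p : E → R) (ends : E → Sym2 V), IsProbVec p → Reduced p ends o a₁ a₂ a₃ b →
      HCov p ends o a₁ a₂ a₃ b) :
    ∀ (p : E → R) (ends : E → Sym2 V), IsProbVec p → HCov p ends o a₁ a₂ a₃ b := by
  suffices key : ∀ n : ℕ, ∀ (p : E → R) (ends : E → Sym2 V), IsProbVec p → (nz p).card = n →
      HCov p ends o a₁ a₂ a₃ b from fun p ends hp => key _ p ends hp rfl
  intro n
  induction n using Nat.strong_induction_on with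
  | _ n ih =>
  intro p ends hp hn
  by_cases hred : Reduced p ends o a₁ a₂ a₃ b
  · exact H p ends hp hred
  obtain ⟨v, hvo, hv1, hv2, hv3, hvb, hviol⟩ : ∃ v, v ≠ o ∧ v ≠ a₁ ∧ v ≠ a₂ ∧ v ≠ a₃ ∧ v ≠ b ∧
      ¬ ((∀ e, p e ≠ 0 → ends e ≠ s(v, v)) ∧ (nzDeg p ends v = 0 ∨ 3 ≤ nzDeg p ends v)) := by
    by_contra hcon
    apply hred
    intro v hvo hv1 hv2 hv3 hvb
    by_contra h
    exact hcon ⟨v, hvo, hv1, hv2, hv3, hvb, h⟩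
  by_cases hloop : ∃ e, p e ≠ 0 ∧ ends e = s(v, v)
  · -- a nonzero loop at `v`: zero it
    obtain ⟨e, hpe, he⟩ := hloop
    have hmem : e ∈ nz p := mem_nz.2 hpe
    have hcard : (nz (Function.update p e 0)).card < n := by
      rw [nz_update_zero, Finset.card_erase_of_mem hmem, hn]
      exact Nat.sub_lt (Nat.pos_of_ne_zero (by rw [← hn]; exact Finset.card_ne_zero_of_mem hmem))
        Nat.one_pos
    have hres := ih _ hcard (Function.update p e 0) ends (hp.update e le_rfl zero_le_one) rfl
    unfold HCov at hres ⊢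
    rwa [Gc_update_zero_of_loop p ends he] at hres
  · -- no nonzero loop at `v`: its nonzero-degree is `1` or `2`
    have hnoloop : ∀ e, p e ≠ 0 → ends e ≠ s(v, v) := fun e hpe he => hloop ⟨e, hpe, he⟩
    have hdeg : nzDeg p ends v = 1 ∨ nzDeg p ends v = 2 := by
      by_contra h
      apply hviol
      refine ⟨hnoloop, ?_⟩
      omega
    -- re-route the zero-weight edges at `v` to loops at `a₁`
    set ends' := reroute p ends a₁ with hends'
    have hagree : ∀ e, p e ≠ 0 → ends e = ends' e := fun e he => (reroute_of_ne p ends a₁ he).symm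
    have hGc : Gc p ends o a₁ a₂ a₃ b = Gc p ends' o a₁ a₂ a₃ b := Gc_congr_nz p hagree o a₁ a₂ a₃ b
    have hS : (Finset.univ.filter (fun e => v ∈ ends' e)).card = nzDeg p ends v :=
      card_filter_reroute p ends hv1
    have hnz : ∀ e, v ∈ ends' e → p e ≠ 0 := fun e he => ne_zero_of_mem_reroute p ends hv1 he
    have hnoloop' : ∀ e, v ∈ ends' e → ends' e ≠ s(v, v) := fun e he h =>
      hnoloop e (hnz e he) (by rw [hagree e (hnz e he)]; exact h)
    unfold HCov
    rw [hGc]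
    rcases hdeg with h1 | h2
    · -- nonzero-degree `1`: `v` is a leaf in `ends'`
      rw [← hS, Finset.card_eq_one] at h1
      obtain ⟨f, hf⟩ := h1
      have hvf : v ∈ ends' f := by
        have : f ∈ Finset.univ.filter (fun e => v ∈ ends' e) := by rw [hf]; exact Finset.mem_singleton_self f
        simpa using this
      have hleaf : ∀ e, v ∈ ends' e → e = f := fun e he => by
        have : e ∈ Finset.univ.filter (fun e => v ∈ ends' e) := by simpa using he
        rw [hf] at this
        exact Finset.mem_singleton.1 this
      obtain ⟨y, hy⟩ := Sym2.mem_iff_exists.1 hvf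
      have hvy : v ≠ y := fun h => hnoloop' f hvf (by rw [hy, h])
      have hpf : p f ≠ 0 := hnz f hvf
      have hmem : f ∈ nz p := mem_nz.2 hpf
      have hcard : (nz (Function.update p f 0)).card < n := by
        rw [nz_update_zero, Finset.card_erase_of_mem hmem, hn]
        exact Nat.sub_lt (Nat.pos_of_ne_zero (by rw [← hn]; exact Finset.card_ne_zero_of_mem hmem))
          Nat.one_pos
      have hres := ih _ hcard (Function.update p f 0) ends' (hp.update f le_rfl zero_le_one) rfl
      unfold HCov at hres
      rwa [SeriesCollapse.Gc_update_leaf p hy hleaf hvy hvo hv1 hv2 hv3 hvb 0] at hres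
    · -- nonzero-degree `2`: the series contraction at `v`
      rw [← hS, Finset.card_eq_two] at h2
      obtain ⟨f, f', hff, hS2⟩ := h2
      have hmemS : ∀ e, v ∈ ends' e ↔ e = f ∨ e = f' := fun e => by
        have : e ∈ Finset.univ.filter (fun e => v ∈ ends' e) ↔ e ∈ ({f, f'} : Finset E) := by
          rw [hS2]
        simpa using this
      have hvf : v ∈ ends' f := (hmemS f).2 (Or.inl rfl)
      have hvf' : v ∈ ends' f' := (hmemS f').2 (Or.inr rfl)
      have hdeg2 : ∀ e, v ∈ ends' e → e = f ∨ e = f' := fun e he => (hmemS e).1 he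
      obtain ⟨w, hw⟩ := Sym2.mem_iff_exists.1 hvf
      obtain ⟨w', hw'⟩ := Sym2.mem_iff_exists.1 hvf'
      have hvw : v ≠ w := fun h => hnoloop' f hvf (by rw [hw, h])
      have hvw' : v ≠ w' := fun h => hnoloop' f' hvf' (by rw [hw', h])
      have hpf' : p f' ≠ 0 := hnz f' hvf'
      have hmem : f' ∈ nz p := mem_nz.2 hpf'
      have hcard : (nz (Function.update (Function.update p f (p f * p f')) f' 0)).card < n := by
        rw [nz_contract p hff hpf', Finset.card_erase_of_mem hmem, hn]
        exact Nat.sub_lt (Nat.pos_of_ne_zero (by rw [← hn]; exact Finset.card_ne_zero_of_mem hmem))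
          Nat.one_pos
      have hp₂ : IsProbVec (Function.update (Function.update p f (p f * p f')) f' 0) :=
        (hp.update f (mul_nonneg (hp.nonneg f) (hp.nonneg f'))
          (mul_le_one₀ (hp.le_one f) (hp.nonneg f') (hp.le_one f'))).update f' le_rfl zero_le_one
      have hres := ih _ hcard _ (Function.update ends' f s(w, w')) hp₂ rfl
      exact (SeriesCollapse.HCov_series_contract p hp hff hw hw' hdeg2 hvw hvw' hvo.symm hv1.symm
        hv2.symm hv3.symm hvb.symm).2 hres

/-- **THE SKELETON REDUCTION OF (HMF)**: if (HMF) holds on every reduced instance on `(E, V)`, it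
holds on every instance. -/
theorem HMF_of_reduced (o a₁ a₂ a₃ b : V)
    (H : ∀ (p : E → R) (ends : E → Sym2 V), IsProbVec p → Reduced p ends o a₁ a₂ a₃ b →
      HMF p ends o a₁ a₂ a₃ b) :
    ∀ (p : E → R) (ends : E → Sym2 V), IsProbVec p → HMF p ends o a₁ a₂ a₃ b := by
  suffices key : ∀ n : ℕ, ∀ (p : E → R) (ends : E → Sym2 V), IsProbVec p → (nz p).card = n →
      HMF p ends o a₁ a₂ a₃ b from fun p ends hp => key _ p ends hp rfl
  intro n
  induction n using Nat.strong_induction_on with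
  | _ n ih =>
  intro p ends hp hn
  by_cases hred : Reduced p ends o a₁ a₂ a₃ b
  · exact H p ends hp hred
  obtain ⟨v, hvo, hv1, hv2, hv3, hvb, hviol⟩ : ∃ v, v ≠ o ∧ v ≠ a₁ ∧ v ≠ a₂ ∧ v ≠ a₃ ∧ v ≠ b ∧
      ¬ ((∀ e, p e ≠ 0 → ends e ≠ s(v, v)) ∧ (nzDeg p ends v = 0 ∨ 3 ≤ nzDeg p ends v)) := by
    by_contra hcon
    apply hred
    intro v hvo hv1 hv2 hv3 hvb
    by_contra h
    exact hcon ⟨v, hvo, hv1, hv2, hv3, hvb, h⟩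
  by_cases hloop : ∃ e, p e ≠ 0 ∧ ends e = s(v, v)
  · obtain ⟨e, hpe, he⟩ := hloop
    have hmem : e ∈ nz p := mem_nz.2 hpe
    have hcard : (nz (Function.update p e 0)).card < n := by
      rw [nz_update_zero, Finset.card_erase_of_mem hmem, hn]
      exact Nat.sub_lt (Nat.pos_of_ne_zero (by rw [← hn]; exact Finset.card_ne_zero_of_mem hmem))
        Nat.one_pos
    have hres := ih _ hcard (Function.update p e 0) ends (hp.update e le_rfl zero_le_one) rfl
    unfold HMF at hres ⊢
    rwa [HMFc_update_zero_of_loop p ends he] at hres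
  · have hnoloop : ∀ e, p e ≠ 0 → ends e ≠ s(v, v) := fun e hpe he => hloop ⟨e, hpe, he⟩
    have hdeg : nzDeg p ends v = 1 ∨ nzDeg p ends v = 2 := by
      by_contra h
      apply hviol
      refine ⟨hnoloop, ?_⟩
      omega
    set ends' := reroute p ends a₁ with hends'
    have hagree : ∀ e, p e ≠ 0 → ends e = ends' e := fun e he => (reroute_of_ne p ends a₁ he).symm
    have hH : HMFc p ends o a₁ a₂ a₃ b = HMFc p ends' o a₁ a₂ a₃ b :=
      HMFc_congr_nz p hagree o a₁ a₂ a₃ b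
    have hS : (Finset.univ.filter (fun e => v ∈ ends' e)).card = nzDeg p ends v :=
      card_filter_reroute p ends hv1
    have hnz : ∀ e, v ∈ ends' e → p e ≠ 0 := fun e he => ne_zero_of_mem_reroute p ends hv1 he
    have hnoloop' : ∀ e, v ∈ ends' e → ends' e ≠ s(v, v) := fun e he h =>
      hnoloop e (hnz e he) (by rw [hagree e (hnz e he)]; exact h)
    unfold HMF
    rw [hH]
    rcases hdeg with h1 | h2
    · rw [← hS, Finset.card_eq_one] at h1
      obtain ⟨f, hf⟩ := h1
      have hvf : v ∈ ends' f := by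
        have : f ∈ Finset.univ.filter (fun e => v ∈ ends' e) := by rw [hf]; exact Finset.mem_singleton_self f
        simpa using this
      have hleaf : ∀ e, v ∈ ends' e → e = f := fun e he => by
        have : e ∈ Finset.univ.filter (fun e => v ∈ ends' e) := by simpa using he
        rw [hf] at this
        exact Finset.mem_singleton.1 this
      obtain ⟨y, hy⟩ := Sym2.mem_iff_exists.1 hvf
      have hvy : v ≠ y := fun h => hnoloop' f hvf (by rw [hy, h])
      have hpf : p f ≠ 0 := hnz f hvf
      have hmem : f ∈ nz p := mem_nz.2 hpf
      have hcard : (nz (Function.update p f 0)).card < n := by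
        rw [nz_update_zero, Finset.card_erase_of_mem hmem, hn]
        exact Nat.sub_lt (Nat.pos_of_ne_zero (by rw [← hn]; exact Finset.card_ne_zero_of_mem hmem))
          Nat.one_pos
      have hres := ih _ hcard (Function.update p f 0) ends' (hp.update f le_rfl zero_le_one) rfl
      unfold HMF at hres
      rwa [HMFLeafInvisible.HMFc_update_leaf p hy hleaf hvy hvo hv1 hv2 hv3 hvb 0] at hres
    · rw [← hS, Finset.card_eq_two] at h2
      obtain ⟨f, f', hff, hS2⟩ := h2
      have hmemS : ∀ e, v ∈ ends' e ↔ e = f ∨ e = f' := fun e => by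
        have : e ∈ Finset.univ.filter (fun e => v ∈ ends' e) ↔ e ∈ ({f, f'} : Finset E) := by
          rw [hS2]
        simpa using this
      have hvf : v ∈ ends' f := (hmemS f).2 (Or.inl rfl)
      have hvf' : v ∈ ends' f' := (hmemS f').2 (Or.inr rfl)
      have hdeg2 : ∀ e, v ∈ ends' e → e = f ∨ e = f' := fun e he => (hmemS e).1 he
      obtain ⟨w, hw⟩ := Sym2.mem_iff_exists.1 hvf
      obtain ⟨w', hw'⟩ := Sym2.mem_iff_exists.1 hvf'
      have hvw : v ≠ w := fun h => hnoloop' f hvf (by rw [hw, h])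
      have hvw' : v ≠ w' := fun h => hnoloop' f' hvf' (by rw [hw', h])
      have hpf' : p f' ≠ 0 := hnz f' hvf'
      have hmem : f' ∈ nz p := mem_nz.2 hpf'
      have hcard : (nz (Function.update (Function.update p f (p f * p f')) f' 0)).card < n := by
        rw [nz_contract p hff hpf', Finset.card_erase_of_mem hmem, hn]
        exact Nat.sub_lt (Nat.pos_of_ne_zero (by rw [← hn]; exact Finset.card_ne_zero_of_mem hmem))
          Nat.one_pos
      have hp₂ : IsProbVec (Function.update (Function.update p f (p f * p f')) f' 0) :=
        (hp.update f (mul_nonneg (hp.nonneg f) (hp.nonneg f'))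
          (mul_le_one₀ (hp.le_one f) (hp.nonneg f') (hp.le_one f'))).update f' le_rfl zero_le_one
      have hres := ih _ hcard _ (Function.update ends' f s(w, w')) hp₂ rfl
      exact (SeriesCollapse.HMF_series_contract p hp hff hw hw' hdeg2 hvw hvw' hvo.symm hv1.symm
        hv2.symm hv3.symm hvb.symm).2 hres

end Main

end Skeleton

end Summit.Ventures.PercRepro2
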